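import Mathlib.Analysis.Complex.Basic
import Mathlib.Data.Matrix.Basis
import Mathlib.LinearAlgebra.Matrix.Trace
import Mathlib.LinearAlgebra.Matrix.NonsingularInverse
import Mathlib.Tactic.LinearCombination
import HarnessLib

/-!
# The Pauli frame of an `𝔰𝔲(2)`-block inside `M_N(ℂ)` and the invariance of the frame sum `Σ_a q(Ad(m) y_a, Ad(m) y_a)` of a real bilinear map
# under `H`-unitary block-diagonal conjugation (trace of a quadratic form is basis-independent; Horn–Johnson §2.2, Hall Prop. 3.24)

Topic `LinearAlgebra/Matrix`; namespaces `Literature.LinearAlgebra.Matrix` (§1) and `Literature.LinearAlgebra.Matrix.SU2Block` (§2–§4).  THEOREMS ONLY (no `def`, no instance,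
no notation, no axiom, no named fact, no `sorry`).  Written for cell `pub/hodgecm-mathlib` (ENGINE T1, crux H413 = `stmt-HodgeConjecture-24833`), ROAD A (A2″) part 2b toward the
(L_{U(2,1)}) letter: it is the linear algebra that makes the transversal Hessian of an orbital integral at a compact wall a CLASS FUNCTION on the singular orbit (consumer:
`NumberTheory/Rogawski1990/ArchCompactWallTransversalTrace`); nothing here is specific to unitary groups over number fields.  Author A-p14 (g28), 2026-09-01.

THE MATHEMATICS.  Fix `i ≠ j` in `Fin N` and the PAULI FRAME of the `(i,j)`-block, `y₁ = i(E_ii − E_jj)`, `y₂ = E_ij − E_ji`, `y₃ = i(E_ij + E_ji)` (`E_kl = Matrix.single k l 1`): an `ℝ`-basis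
of the traceless skew-hermitian matrices supported in the block, orthonormal for `⟪X, Y⟫ = −½ tr(XY)`.
* §1 `sum_apply_apply_eq_of_transpose_mul_self_eq_one` — for a real bilinear `q : W → W → E`, a family `y : Fin n → W` and a real matrix `O` with `Oᵀ O = 1`:
  `Σ_a q(y′_a, y′_a) = Σ_a q(y_a, y_a)` whenever `y′_a = Σ_b O_ab • y_b` (the trace of a quadratic form does not depend on the orthonormal basis).
* §2 the block calculus: entries of the frame combinations `a•y₁ + b•y₂ + c•y₃` (`frame_entries`), the EXPANSION of every block-supported traceless skew-hermitian `X` as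
  `Im X_ii • y₁ + Re X_ij • y₂ + Im X_ij • y₃` (`eq_frame_of_block`), `tr((a•y₁+b•y₂+c•y₃)(a′•y₁+b′•y₂+c′•y₃)) = −2(aa′ + bb′ + cc′)` (`trace_frame_mul_frame`), skewness and block-trace zero.
* §3 conjugation by an `H`-UNITARY BLOCK-DIAGONAL matrix `M` (`Mᴴ H M = H`, `H = diag e` real with `e_i = e_j`, `M` commuting with a diagonal `diag d` whose `d`-class of `i` is `{i,j}`,
  `M M′ = M′ M = 1`): `M Y M′` stays block-supported (`conj_apply_eq_zero_of_block`), skew-hermitian (`conjTranspose_conj_eq_neg_of_block`: `M′ = H⁻¹MᴴH` and `H` is scalar on the block)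
  and has the same trace.
* §4 **`sum_conj_frame_eq_sum_frame`** — for every real bilinear `q : M_N(ℂ) → M_N(ℂ) → E`:  `Σ_{a=1}^{3} q(M y_a M′, M y_a M′) = Σ_{a=1}^{3} q(y_a, y_a)`.  Proof: by §2–§3 each `M y_a M′`
  expands in the frame with a real coefficient matrix `O`; its rows are orthonormal because `tr` is conjugation-invariant and the frame is `⟪·,·⟫`-orthonormal, so `O Oᵀ = 1 = Oᵀ O`; §1.
HONEST LABEL: elementary linear algebra; for the cell it pays nothing by itself (HC_CM is proved only modulo the printed citations until rung 0 closes).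

## References
* [HornJohnson2013] R. A. Horn, C. R. Johnson, *Matrix Analysis*, 2nd ed. (2013), §2.2 (unitary similarity; `tr` and the Frobenius form are unitarily invariant), §4.1.
* [Hall2015] B. C. Hall, *Lie Groups, Lie Algebras, and Representations*, 2nd ed., GTM 222 (2015), Prop. 3.24 and §1.2 (the adjoint action of `U(2)` on `𝔰𝔲(2) ≅ ℝ³` is by rotations).
-/

set_option autoImplicit false

noncomputable section

open Finset Matrix Complex
open scoped ComplexConjugate

namespace Literature.LinearAlgebra.Matrix

/-! ## §1 The trace of a quadratic form is basis-independent (coordinate form) -/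

/-- **THE TRACE OF A QUADRATIC FORM IS BASIS-INDEPENDENT** (coordinate form): for a real bilinear `q : W → W → E`, families `y y′ : Fin n → W` and a real `n × n` matrix `O` with
`Oᵀ O = 1` such that `y′_a = Σ_b O_ab • y_b`, one has `Σ_a q(y′_a, y′_a) = Σ_a q(y_a, y_a)` (expand and use `Σ_a O_ab O_ac = δ_bc`). [cite: HornJohnson2013, §2.2] -/
theorem sum_apply_apply_eq_of_transpose_mul_self_eq_one {W E : Type*} [AddCommGroup W] [Module ℝ W] [AddCommGroup E] [Module ℝ E]
    (q : W →ₗ[ℝ] W →ₗ[ℝ] E) {n : ℕ} (y y' : Fin n → W) (O : Matrix (Fin n) (Fin n) ℝ) (hO : Oᵀ * O = 1)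
    (hy' : ∀ a, y' a = ∑ b, O a b • y b) :
    ∑ a, q (y' a) (y' a) = ∑ a, q (y a) (y a) := by
  have expand : ∀ a, q (y' a) (y' a) = ∑ c, ∑ b, (O a b * O a c) • q (y b) (y c) := fun a => by
    rw [hy', map_sum]
    simp only [LinearMap.sum_apply, map_sum, map_smul, LinearMap.smul_apply, Finset.smul_sum, smul_smul]
    exact Finset.sum_congr rfl fun c _ => Finset.sum_congr rfl fun b _ => by rw [mul_comm]
  have hδ : ∀ b c, ∑ a, O a b * O a c = if b = c then 1 else 0 := fun b c => by
    have h := congr_fun (congr_fun hO b) c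
    rw [Matrix.mul_apply, Matrix.one_apply] at h
    simpa only [Matrix.transpose_apply] using h
  simp_rw [expand]
  rw [Finset.sum_comm]
  refine Finset.sum_congr rfl fun c _ => ?_
  rw [Finset.sum_comm]
  simp_rw [← Finset.sum_smul, hδ, ite_smul, one_smul, zero_smul]
  rw [Finset.sum_ite_eq' Finset.univ c, if_pos (Finset.mem_univ _)]


end Literature.LinearAlgebra.Matrix

namespace Literature.LinearAlgebra.Matrix.SU2Block

variable {N : ℕ}

/-! ## §2 The Pauli frame of the `(i,j)`-block: entries, expansion, trace form -/

/-- Case analysis on a `2 × 2` block: a predicate on index pairs holding at `(i,i), (i,j), (j,i), (j,j)` and off the block holds everywhere (private plumbing). [folklore] -/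
private theorem forall_of_block {i j : Fin N} (P : Fin N → Fin N → Prop) (hii : P i i) (hij' : P i j) (hji : P j i) (hjj : P j j)
    (hoff : ∀ k l, ¬((k = i ∨ k = j) ∧ (l = i ∨ l = j)) → P k l) : ∀ k l, P k l := by
  intro k l
  by_cases h : (k = i ∨ k = j) ∧ (l = i ∨ l = j)
  · rcases h with ⟨hk | hk, hl | hl⟩ <;> subst hk <;> subst hl <;> assumption
  · exact hoff k l h

/-- **ENTRIES OF A FRAME COMBINATION** `F = a•y₁ + b•y₂ + c•y₃` (`i ≠ j`): `F_ii = ia`, `F_ij = b + ic`, `F_ji = −b + ic`, `F_jj = −ia`, and `F_kl = 0` off the block. [cite: Hall2015, §1.2] -/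
theorem frame_entries {i j : Fin N} (hij : i ≠ j) (a b c : ℝ) :
    ((a • (I • (Matrix.single i i (1 : ℂ) - Matrix.single j j 1)) + b • (Matrix.single i j (1 : ℂ) - Matrix.single j i 1) +
        c • (I • (Matrix.single i j (1 : ℂ) + Matrix.single j i 1)) : Matrix (Fin N) (Fin N) ℂ) i i) = a * I ∧
    ((a • (I • (Matrix.single i i (1 : ℂ) - Matrix.single j j 1)) + b • (Matrix.single i j (1 : ℂ) - Matrix.single j i 1) +
        c • (I • (Matrix.single i j (1 : ℂ) + Matrix.single j i 1)) : Matrix (Fin N) (Fin N) ℂ) i j) = b + c * I ∧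
    ((a • (I • (Matrix.single i i (1 : ℂ) - Matrix.single j j 1)) + b • (Matrix.single i j (1 : ℂ) - Matrix.single j i 1) +
        c • (I • (Matrix.single i j (1 : ℂ) + Matrix.single j i 1)) : Matrix (Fin N) (Fin N) ℂ) j i) = -b + c * I ∧
    ((a • (I • (Matrix.single i i (1 : ℂ) - Matrix.single j j 1)) + b • (Matrix.single i j (1 : ℂ) - Matrix.single j i 1) +
        c • (I • (Matrix.single i j (1 : ℂ) + Matrix.single j i 1)) : Matrix (Fin N) (Fin N) ℂ) j j) = -(a * I) ∧
    ∀ k l, ¬((k = i ∨ k = j) ∧ (l = i ∨ l = j)) →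
      ((a • (I • (Matrix.single i i (1 : ℂ) - Matrix.single j j 1)) + b • (Matrix.single i j (1 : ℂ) - Matrix.single j i 1) +
        c • (I • (Matrix.single i j (1 : ℂ) + Matrix.single j i 1)) : Matrix (Fin N) (Fin N) ℂ) k l) = 0 := by
  refine ⟨?_, ?_, ?_, ?_, fun k l hkl => ?_⟩
  · simp [Matrix.single, hij.symm, Complex.real_smul]
  · simp [Matrix.single, hij, hij.symm, Complex.real_smul]
  · simp [Matrix.single, hij, hij.symm, Complex.real_smul]
  · simp [Matrix.single, hij, Complex.real_smul]
  · have hk : (k ≠ i ∧ k ≠ j) ∨ (l ≠ i ∧ l ≠ j) := by tauto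
    rcases hk with hk | hl
    · simp [Matrix.single, Ne.symm hk.1, Ne.symm hk.2]
    · simp [Matrix.single, Ne.symm hl.1, Ne.symm hl.2]

/-- **EXPANSION IN THE PAULI FRAME**: a skew-hermitian matrix `X` supported in the `(i,j)`-block with `X_ii + X_jj = 0` equals `Im X_ii • y₁ + Re X_ij • y₂ + Im X_ij • y₃`
(`𝔰𝔲(2) = ℝ y₁ ⊕ ℝ y₂ ⊕ ℝ y₃`). [cite: Hall2015, §1.2] -/
theorem eq_frame_of_block {i j : Fin N} (hij : i ≠ j) (X : Matrix (Fin N) (Fin N) ℂ) (hskew : Xᴴ = -X)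
    (hsupp : ∀ k l, ¬((k = i ∨ k = j) ∧ (l = i ∨ l = j)) → X k l = 0) (htr : X i i + X j j = 0) :
    X = (X i i).im • (I • (Matrix.single i i (1 : ℂ) - Matrix.single j j 1)) + (X i j).re • (Matrix.single i j (1 : ℂ) - Matrix.single j i 1) +
      (X i j).im • (I • (Matrix.single i j (1 : ℂ) + Matrix.single j i 1)) := by
  obtain ⟨a, ha⟩ : ∃ a : ℝ, (X i i).im = a := ⟨_, rfl⟩
  obtain ⟨b, hb⟩ : ∃ b : ℝ, (X i j).re = b := ⟨_, rfl⟩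
  obtain ⟨c, hc⟩ : ∃ c : ℝ, (X i j).im = c := ⟨_, rfl⟩
  have hsk : ∀ k l, X k l = -conj (X l k) := fun k l => by
    have h := congr_fun (congr_fun hskew k) l
    rw [conjTranspose_apply, Matrix.neg_apply, Complex.star_def] at h
    rw [h, neg_neg]
  have hXii : X i i = a * I := by
    apply Complex.ext
    · have h := congrArg Complex.re (hsk i i)
      simp only [Complex.neg_re, Complex.conj_re] at h
      have h0 : (X i i).re = 0 := by linarith
      simp [h0]
    · simp [ha]
  have hXij : X i j = b + c * I := Complex.ext (by simp [hb]) (by simp [hc])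
  have hXji : X j i = -b + c * I := by
    rw [hsk j i, hXij]
    apply Complex.ext <;> simp
  have hXjj : X j j = -(a * I) := by rw [← hXii]; linear_combination htr
  obtain ⟨h1, h2, h3, h4, h5⟩ := frame_entries hij a b c
  rw [ha, hb, hc]
  ext k l
  refine forall_of_block (i := i) (j := j) (fun k l => X k l = _) ?_ ?_ ?_ ?_ (fun k l hkl => ?_) k l
  · rw [hXii]; exact h1.symm
  · rw [hXij]; exact h2.symm
  · rw [hXji]; exact h3.symm
  · rw [hXjj]; exact h4.symm
  · rw [hsupp k l hkl]; exact (h5 k l hkl).symm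




/-- **THE FRAME IS ORTHONORMAL FOR `−½ tr(XY)`**: `tr((a•y₁ + b•y₂ + c•y₃)(a′•y₁ + b′•y₂ + c′•y₃)) = −2(aa′ + bb′ + cc′)` (`y_a y_b + y_b y_a = −2δ_ab` on the block). [cite: Hall2015, §1.2] -/
theorem trace_frame_mul_frame {i j : Fin N} (hij : i ≠ j) (a b c a' b' c' : ℝ) :
    Matrix.trace (((a • (I • (Matrix.single i i (1 : ℂ) - Matrix.single j j 1)) + b • (Matrix.single i j (1 : ℂ) - Matrix.single j i 1) +
        c • (I • (Matrix.single i j (1 : ℂ) + Matrix.single j i 1)) : Matrix (Fin N) (Fin N) ℂ)) *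
      ((a' • (I • (Matrix.single i i (1 : ℂ) - Matrix.single j j 1)) + b' • (Matrix.single i j (1 : ℂ) - Matrix.single j i 1) +
        c' • (I • (Matrix.single i j (1 : ℂ) + Matrix.single j i 1)) : Matrix (Fin N) (Fin N) ℂ))) =
      -2 * ((a * a' + b * b' + c * c' : ℝ) : ℂ) := by
  simp only [RCLike.real_smul_eq_coe_smul (K := ℂ), Matrix.mul_add, Matrix.add_mul, Matrix.mul_sub, Matrix.sub_mul, Matrix.smul_mul, Matrix.mul_smul,
    smul_add, smul_sub, Matrix.trace_neg, smul_neg, Matrix.single_mul_single_same, Matrix.single_mul_single_of_ne, hij, hij.symm, ne_eq, not_false_eq_true, Matrix.trace_add,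
    Matrix.trace_sub, Matrix.trace_smul, smul_zero, sub_zero, zero_sub, add_zero, zero_add, Matrix.trace_single_eq_same,
    Matrix.trace_single_eq_of_ne, mul_one, mul_zero, smul_eq_mul]
  have hI : I * I = -1 := Complex.I_mul_I
  push_cast
  linear_combination (2 * ((a' : ℂ) * a + (c : ℂ) * c')) * hI

/-! ## §3 Conjugation by `H`-unitary block-diagonal matrices -/

/-- A matrix commuting with `diag d` has `M_kl = 0` whenever `d_k ≠ d_l` (block diagonality along the level sets of `d`). [cite: HornJohnson2013, §4.1] -/
theorem apply_eq_zero_of_mul_diagonal_eq {d : Fin N → ℂ} {M : Matrix (Fin N) (Fin N) ℂ} (hM : M * Matrix.diagonal d = Matrix.diagonal d * M)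
    {k l : Fin N} (hkl : d k ≠ d l) : M k l = 0 := by
  have h := congr_fun (congr_fun hM k) l
  rw [Matrix.mul_diagonal, Matrix.diagonal_mul] at h
  have h1 : M k l * (d l - d k) = 0 := by rw [mul_sub, h, mul_comm, sub_self]
  rcases mul_eq_zero.1 h1 with h2 | h2
  · exact h2
  · exact absurd (sub_eq_zero.1 h2).symm hkl

/-- **BLOCK SUPPORT IS PRESERVED**: if `M` and `M′` commute with `diag d`, the `d`-class of `i` is `{i, j}`, and `Y` is supported in the `(i,j)`-block, then so is `M Y M′`.
[cite: HornJohnson2013, §4.1] -/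
theorem conj_apply_eq_zero_of_block {i j : Fin N} {d : Fin N → ℂ} (hS : ∀ k, d k = d i ↔ (k = i ∨ k = j))
    {M M' Y : Matrix (Fin N) (Fin N) ℂ} (hM : M * Matrix.diagonal d = Matrix.diagonal d * M) (hM' : M' * Matrix.diagonal d = Matrix.diagonal d * M')
    (hY : ∀ k l, ¬((k = i ∨ k = j) ∧ (l = i ∨ l = j)) → Y k l = 0) :
    ∀ k l, ¬((k = i ∨ k = j) ∧ (l = i ∨ l = j)) → (M * Y * M') k l = 0 := by
  intro k l hkl
  have hk : ¬(k = i ∨ k = j) ∨ ¬(l = i ∨ l = j) := by tauto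
  rcases hk with hk | hl
  · -- row `k` outside the block: `M k p = 0` for `p` in the block, `Y p q = 0` for `p` outside
    rw [Matrix.mul_assoc, Matrix.mul_apply]
    refine Finset.sum_eq_zero fun p _ => ?_
    by_cases hp : p = i ∨ p = j
    · have hdk : d k ≠ d p := fun h => hk ((hS k).1 (h.trans ((hS p).2 hp)))
      rw [apply_eq_zero_of_mul_diagonal_eq hM hdk, zero_mul]
    · rw [Matrix.mul_apply, Finset.sum_eq_zero fun q _ => by rw [hY p q (by tauto), zero_mul], mul_zero]
  · rw [Matrix.mul_apply]
    refine Finset.sum_eq_zero fun q _ => ?_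
    by_cases hq : q = i ∨ q = j
    · have hdq : d q ≠ d l := fun h => hl ((hS l).1 (h.symm.trans ((hS q).2 hq)))
      rw [apply_eq_zero_of_mul_diagonal_eq hM' hdq, mul_zero]
    · rw [Matrix.mul_apply, Finset.sum_eq_zero fun p _ => by rw [hY p q (by tauto), mul_zero], zero_mul]

/-- A diagonal matrix `diag e` with `e_i = e_j` commutes with every matrix supported in the `(i,j)`-block. [cite: HornJohnson2013, §4.1] -/
theorem diagonal_mul_eq_mul_diagonal_of_block {i j : Fin N} {e : Fin N → ℂ} (heij : e i = e j) {Y : Matrix (Fin N) (Fin N) ℂ}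
    (hY : ∀ k l, ¬((k = i ∨ k = j) ∧ (l = i ∨ l = j)) → Y k l = 0) :
    Matrix.diagonal e * Y = Y * Matrix.diagonal e := by
  ext k l
  rw [Matrix.diagonal_mul, Matrix.mul_diagonal]
  by_cases hkl : (k = i ∨ k = j) ∧ (l = i ∨ l = j)
  · have hek : e k = e i := by rcases hkl.1 with h | h <;> rw [h]; exact heij.symm
    have hel : e l = e i := by rcases hkl.2 with h | h <;> rw [h]; exact heij.symm
    rw [hek, hel, mul_comm]
  · rw [hY k l hkl, mul_zero, zero_mul]

/-- The trace of a matrix supported in the `(i,j)`-block (`i ≠ j`) is `Y_ii + Y_jj`. [cite: HornJohnson2013, §4.1] -/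
theorem trace_eq_add_of_block {i j : Fin N} (hij : i ≠ j) {Y : Matrix (Fin N) (Fin N) ℂ}
    (hY : ∀ k l, ¬((k = i ∨ k = j) ∧ (l = i ∨ l = j)) → Y k l = 0) : Matrix.trace Y = Y i i + Y j j := by
  rw [Matrix.trace]
  exact Finset.sum_eq_add i j hij (fun k _ hk => by rw [Matrix.diag_apply]; exact hY k k (by tauto)) (fun h => absurd (Finset.mem_univ _) h)
    (fun h => absurd (Finset.mem_univ _) h)




/-- **THE `H`-ADJOINT INVERSE**: if `Mᴴ (diag e) M = diag e` with all `e_k ≠ 0` and `M M′ = 1`, then `M′ = diag(e⁻¹) Mᴴ diag(e)` (`H`-unitary matrices: `M⁻¹ = H⁻¹MᴴH`).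
[cite: HornJohnson2013, §2.2] -/
theorem inv_eq_diagonal_inv_mul_conjTranspose_mul_diagonal {e : Fin N → ℂ} (he : ∀ k, e k ≠ 0) {M M' : Matrix (Fin N) (Fin N) ℂ}
    (hMH : Mᴴ * Matrix.diagonal e * M = Matrix.diagonal e) (hMM' : M * M' = 1) :
    M' = Matrix.diagonal (fun k => (e k)⁻¹) * Mᴴ * Matrix.diagonal e := by
  have hee : Matrix.diagonal (fun k => (e k)⁻¹) * Matrix.diagonal e = 1 := by
    rw [Matrix.diagonal_mul_diagonal, ← Matrix.diagonal_one]
    congr 1; funext k; exact inv_mul_cancel₀ (he k)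
  have hleft : Matrix.diagonal (fun k => (e k)⁻¹) * Mᴴ * Matrix.diagonal e * M = 1 := by
    rw [Matrix.mul_assoc (Matrix.diagonal _ * Mᴴ), Matrix.mul_assoc (Matrix.diagonal _), ← Matrix.mul_assoc Mᴴ, hMH, hee]
  calc M' = Matrix.diagonal (fun k => (e k)⁻¹) * Mᴴ * Matrix.diagonal e * M * M' := by rw [hleft, Matrix.one_mul]
    _ = _ := by rw [Matrix.mul_assoc _ M M', hMM', Matrix.mul_one]

/-- **SKEWNESS IS PRESERVED**: for `H = diag e` real, nowhere zero, with `e_i = e_j`, an `H`-unitary `M` (`MᴴHM = H`, two-sided inverse `M′`) commuting with a diagonal `diag d` whose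
`d`-class of `i` is `{i,j}`, and a skew-hermitian `Y` supported in the `(i,j)`-block: `(M Y M′)ᴴ = −(M Y M′)` (`M′ = H⁻¹MᴴH`, and `H` is scalar on the block, so it commutes with `Y`
and with the block-supported `M Y M′`). [cite: HornJohnson2013, §2.2] -/
theorem conjTranspose_conj_eq_neg_of_block {i j : Fin N} {e : Fin N → ℂ} (he : ∀ k, e k ≠ 0) (hereal : ∀ k, conj (e k) = e k) (heij : e i = e j)
    {d : Fin N → ℂ} (hS : ∀ k, d k = d i ↔ (k = i ∨ k = j)) {M M' Y : Matrix (Fin N) (Fin N) ℂ}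
    (hMH : Mᴴ * Matrix.diagonal e * M = Matrix.diagonal e) (hMM' : M * M' = 1) (hM'M : M' * M = 1)
    (hM : M * Matrix.diagonal d = Matrix.diagonal d * M) (hY : ∀ k l, ¬((k = i ∨ k = j) ∧ (l = i ∨ l = j)) → Y k l = 0) (hYskew : Yᴴ = -Y) :
    (M * Y * M')ᴴ = -(M * Y * M') := by
  have hM'd : M' * Matrix.diagonal d = Matrix.diagonal d * M' := by
    calc M' * Matrix.diagonal d = M' * Matrix.diagonal d * (M * M') := by rw [hMM', Matrix.mul_one]
      _ = M' * (M * Matrix.diagonal d) * M' := by rw [hM]; simp only [Matrix.mul_assoc]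
      _ = Matrix.diagonal d * M' := by rw [← Matrix.mul_assoc, hM'M, Matrix.one_mul]
  have hblk := conj_apply_eq_zero_of_block hS hM hM'd hY
  have hM'eq := inv_eq_diagonal_inv_mul_conjTranspose_mul_diagonal he hMH hMM'
  have hDe : (Matrix.diagonal e)ᴴ = Matrix.diagonal e := by
    rw [Matrix.diagonal_conjTranspose]; congr 1; funext k; exact hereal k
  have hDe' : (Matrix.diagonal fun k => (e k)⁻¹)ᴴ = Matrix.diagonal fun k => (e k)⁻¹ := by
    rw [Matrix.diagonal_conjTranspose]; congr 1; funext k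
    rw [Pi.star_apply, star_inv₀, Complex.star_def, hereal k]
  have heij' : (e i)⁻¹ = (e j)⁻¹ := by rw [heij]
  -- `H⁻¹ Y = Y H⁻¹` and `H (MYM') = (MYM') H`
  have hcommY := diagonal_mul_eq_mul_diagonal_of_block (e := fun k => (e k)⁻¹) heij' hY
  have hcommZ := diagonal_mul_eq_mul_diagonal_of_block heij hblk
  have hee : Matrix.diagonal e * Matrix.diagonal (fun k => (e k)⁻¹) = 1 := by
    rw [Matrix.diagonal_mul_diagonal, ← Matrix.diagonal_one]
    congr 1; funext k; exact mul_inv_cancel₀ (he k)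
  calc (M * Y * M')ᴴ = M'ᴴ * Yᴴ * Mᴴ := by rw [Matrix.conjTranspose_mul, Matrix.conjTranspose_mul, Matrix.mul_assoc]
    _ = Matrix.diagonal e * M * Matrix.diagonal (fun k => (e k)⁻¹) * (-Y) * Mᴴ := by
        rw [hYskew, hM'eq, Matrix.conjTranspose_mul, Matrix.conjTranspose_mul, hDe, hDe', Matrix.conjTranspose_conjTranspose, ← Matrix.mul_assoc]
    _ = -(Matrix.diagonal e * (M * Y * (Matrix.diagonal (fun k => (e k)⁻¹) * Mᴴ * Matrix.diagonal e)) * Matrix.diagonal (fun k => (e k)⁻¹)) := by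
        rw [Matrix.mul_neg, Matrix.neg_mul, Matrix.mul_assoc (Matrix.diagonal e * M), hcommY]
        simp only [Matrix.mul_assoc, hee, Matrix.mul_one]
    _ = -(M * Y * M') := by rw [← hM'eq, hcommZ, Matrix.mul_assoc, hee, Matrix.mul_one]

/-- The frame combinations `a•y₁ + b•y₂ + c•y₃` (`a b c` real) are skew-hermitian. [cite: Hall2015, §1.2] -/
theorem conjTranspose_frame_eq_neg {i j : Fin N} (hij : i ≠ j) (a b c : ℝ) :
    ((a • (I • (Matrix.single i i (1 : ℂ) - Matrix.single j j 1)) + b • (Matrix.single i j (1 : ℂ) - Matrix.single j i 1) +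
        c • (I • (Matrix.single i j (1 : ℂ) + Matrix.single j i 1)) : Matrix (Fin N) (Fin N) ℂ))ᴴ =
      -((a • (I • (Matrix.single i i (1 : ℂ) - Matrix.single j j 1)) + b • (Matrix.single i j (1 : ℂ) - Matrix.single j i 1) +
        c • (I • (Matrix.single i j (1 : ℂ) + Matrix.single j i 1)) : Matrix (Fin N) (Fin N) ℂ)) := by
  obtain ⟨h1, h2, h3, h4, h5⟩ := frame_entries hij a b c
  set F : Matrix (Fin N) (Fin N) ℂ := (a • (I • (Matrix.single i i (1 : ℂ) - Matrix.single j j 1)) + b • (Matrix.single i j (1 : ℂ) - Matrix.single j i 1) +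
        c • (I • (Matrix.single i j (1 : ℂ) + Matrix.single j i 1)) : Matrix (Fin N) (Fin N) ℂ) with hF
  ext k l
  rw [Matrix.conjTranspose_apply, Matrix.neg_apply]
  refine forall_of_block (i := i) (j := j) (fun k l => star (F l k) = -F k l) ?_ ?_ ?_ ?_ (fun k l hkl => ?_) k l
  · rw [h1, Complex.star_def]; apply Complex.ext <;> simp
  · rw [h3, h2, Complex.star_def]; apply Complex.ext <;> simp
  · rw [h2, h3, Complex.star_def]; apply Complex.ext <;> simp
  · rw [h4, Complex.star_def]; apply Complex.ext <;> simp
  · rw [h5 k l hkl, h5 l k (by tauto), star_zero, neg_zero]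

/-- The frame combinations have block trace zero: `F_ii + F_jj = 0`. [cite: Hall2015, §1.2] -/
theorem frame_apply_add_apply {i j : Fin N} (hij : i ≠ j) (a b c : ℝ) :
    ((a • (I • (Matrix.single i i (1 : ℂ) - Matrix.single j j 1)) + b • (Matrix.single i j (1 : ℂ) - Matrix.single j i 1) +
        c • (I • (Matrix.single i j (1 : ℂ) + Matrix.single j i 1)) : Matrix (Fin N) (Fin N) ℂ) i i) +
      ((a • (I • (Matrix.single i i (1 : ℂ) - Matrix.single j j 1)) + b • (Matrix.single i j (1 : ℂ) - Matrix.single j i 1) +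
        c • (I • (Matrix.single i j (1 : ℂ) + Matrix.single j i 1)) : Matrix (Fin N) (Fin N) ℂ) j j) = 0 := by
  obtain ⟨h1, -, -, h4, -⟩ := frame_entries hij a b c
  rw [h1, h4, add_neg_cancel]


/-! ## §4 The invariance of the frame sum -/

/-- **THE FRAME SUM OF A REAL BILINEAR MAP IS INVARIANT UNDER `H`-UNITARY BLOCK-DIAGONAL CONJUGATION**: with `H = diag e` (real, nowhere zero, `e_i = e_j`), `M` `H`-unitary with
two-sided inverse `M′` and commuting with a diagonal `diag d` whose `d`-class of `i` is `{i, j}` (`i ≠ j`), for EVERY real bilinear `q : M_N(ℂ) → M_N(ℂ) → E`: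
`q(My₁M′, My₁M′) + q(My₂M′, My₂M′) + q(My₃M′, My₃M′) = q(y₁,y₁) + q(y₂,y₂) + q(y₃,y₃)` for the Pauli frame `y₁ = i(E_ii − E_jj)`, `y₂ = E_ij − E_ji`, `y₃ = i(E_ij + E_ji)`.
Proof: `M y_a M′ = Σ_b O_ab • y_b` (§2–§3) with `O Oᵀ = 1` (the form `−½tr(XY)` is `Ad`-invariant and the frame orthonormal), hence `Oᵀ O = 1`, and §1.  This is «`Ad(m)` acts on
`𝔰𝔲(2) ≅ ℝ³` by a rotation, and the trace of a quadratic form is rotation-invariant». [cite: Hall2015, Prop. 3.24] [cite: HornJohnson2013, §2.2] -/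
theorem sum_conj_frame_eq_sum_frame {E : Type*} [AddCommGroup E] [Module ℝ E]
    (q : Matrix (Fin N) (Fin N) ℂ →ₗ[ℝ] Matrix (Fin N) (Fin N) ℂ →ₗ[ℝ] E) {i j : Fin N} (hij : i ≠ j)
    {e : Fin N → ℂ} (he : ∀ k, e k ≠ 0) (hereal : ∀ k, conj (e k) = e k) (heij : e i = e j)
    {d : Fin N → ℂ} (hS : ∀ k, d k = d i ↔ (k = i ∨ k = j)) {M M' : Matrix (Fin N) (Fin N) ℂ}
    (hMH : Mᴴ * Matrix.diagonal e * M = Matrix.diagonal e) (hMM' : M * M' = 1) (hM'M : M' * M = 1) (hM : M * Matrix.diagonal d = Matrix.diagonal d * M) :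
    q (M * (I • (Matrix.single i i (1 : ℂ) - Matrix.single j j 1)) * M') (M * (I • (Matrix.single i i (1 : ℂ) - Matrix.single j j 1)) * M') +
      q (M * (Matrix.single i j (1 : ℂ) - Matrix.single j i 1) * M') (M * (Matrix.single i j (1 : ℂ) - Matrix.single j i 1) * M') +
      q (M * (I • (Matrix.single i j (1 : ℂ) + Matrix.single j i 1)) * M') (M * (I • (Matrix.single i j (1 : ℂ) + Matrix.single j i 1)) * M') =
    q (I • (Matrix.single i i (1 : ℂ) - Matrix.single j j 1)) (I • (Matrix.single i i (1 : ℂ) - Matrix.single j j 1)) +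
      q (Matrix.single i j (1 : ℂ) - Matrix.single j i 1) (Matrix.single i j (1 : ℂ) - Matrix.single j i 1) +
      q (I • (Matrix.single i j (1 : ℂ) + Matrix.single j i 1)) (I • (Matrix.single i j (1 : ℂ) + Matrix.single j i 1)) := by
  -- the frame as a `Fin 3`-family, and every member as a frame combination
  set y : Fin 3 → Matrix (Fin N) (Fin N) ℂ :=
    ![I • (Matrix.single i i (1 : ℂ) - Matrix.single j j 1), Matrix.single i j (1 : ℂ) - Matrix.single j i 1, I • (Matrix.single i j (1 : ℂ) + Matrix.single j i 1)] with hy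
  have hy0 : y 0 = I • (Matrix.single i i (1 : ℂ) - Matrix.single j j 1) := rfl
  have hy1 : y 1 = Matrix.single i j (1 : ℂ) - Matrix.single j i 1 := rfl
  have hy2 : y 2 = I • (Matrix.single i j (1 : ℂ) + Matrix.single j i 1) := rfl
  have hyF : ∀ a, y a = ((if a = 0 then (1 : ℝ) else 0) • (I • (Matrix.single i i (1 : ℂ) - Matrix.single j j 1)) +
      (if a = 1 then (1 : ℝ) else 0) • (Matrix.single i j (1 : ℂ) - Matrix.single j i 1) +
      (if a = 2 then (1 : ℝ) else 0) • (I • (Matrix.single i j (1 : ℂ) + Matrix.single j i 1)) : Matrix (Fin N) (Fin N) ℂ) := fun a => by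
    fin_cases a <;> simp [hy0, hy1, hy2]
  -- `M'` is block diagonal too
  have hM'd : M' * Matrix.diagonal d = Matrix.diagonal d * M' := by
    calc M' * Matrix.diagonal d = M' * Matrix.diagonal d * (M * M') := by rw [hMM', Matrix.mul_one]
      _ = M' * (M * Matrix.diagonal d) * M' := by rw [hM]; simp only [Matrix.mul_assoc]
      _ = Matrix.diagonal d * M' := by rw [← Matrix.mul_assoc, hM'M, Matrix.one_mul]
  -- the conjugates `X_a := M y_a M'` are block-supported, skew-hermitian and traceless on the block
  have hysupp : ∀ a, ∀ k l, ¬((k = i ∨ k = j) ∧ (l = i ∨ l = j)) → y a k l = 0 := fun a => by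
    rw [hyF a]; exact (frame_entries hij _ _ _).2.2.2.2
  have hXsupp : ∀ a, ∀ k l, ¬((k = i ∨ k = j) ∧ (l = i ∨ l = j)) → (M * y a * M') k l = 0 := fun a =>
    conj_apply_eq_zero_of_block hS hM hM'd (hysupp a)
  have hXskew : ∀ a, (M * y a * M')ᴴ = -(M * y a * M') := fun a => by
    refine conjTranspose_conj_eq_neg_of_block he hereal heij hS hMH hMM' hM'M hM (hysupp a) ?_
    rw [hyF a]; exact conjTranspose_frame_eq_neg hij _ _ _
  have htrconj : ∀ Y : Matrix (Fin N) (Fin N) ℂ, Matrix.trace (M * Y * M') = Matrix.trace Y := fun Y => by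
    rw [Matrix.trace_mul_cycle, hM'M, Matrix.one_mul]
  have hXtr : ∀ a, (M * y a * M') i i + (M * y a * M') j j = 0 := fun a => by
    rw [← trace_eq_add_of_block hij (hXsupp a), htrconj, trace_eq_add_of_block hij (hysupp a), hyF a]
    exact frame_apply_add_apply hij _ _ _
  -- the coefficient matrix `O` and the expansion `X_a = Σ_b O_ab • y_b`
  set O : Matrix (Fin 3) (Fin 3) ℝ := Matrix.of fun a b =>
    (![((M * y a * M') i i).im, ((M * y a * M') i j).re, ((M * y a * M') i j).im] : Fin 3 → ℝ) b with hO
  have hO0 : ∀ a, O a 0 = ((M * y a * M') i i).im := fun a => rfl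
  have hO1 : ∀ a, O a 1 = ((M * y a * M') i j).re := fun a => rfl
  have hO2 : ∀ a, O a 2 = ((M * y a * M') i j).im := fun a => rfl
  have hy' : ∀ a, M * y a * M' = ∑ b, O a b • y b := fun a => by
    rw [Fin.sum_univ_three, hO0, hO1, hO2, hy0, hy1, hy2]
    exact eq_frame_of_block hij _ (hXskew a) (hXsupp a) (hXtr a)
  -- `O` has orthonormal rows: `Σ_b O_ab O_a'b = δ_aa'` (the trace form `−½ tr(XY)` is `Ad`-invariant and the frame is orthonormal for it)
  have hrow : ∀ a a', O a 0 * O a' 0 + O a 1 * O a' 1 + O a 2 * O a' 2 = if a = a' then 1 else 0 := fun a a' => by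
    have h1 : Matrix.trace ((M * y a * M') * (M * y a' * M')) = -2 * (((O a 0 * O a' 0 + O a 1 * O a' 1 + O a 2 * O a' 2 : ℝ)) : ℂ) := by
      rw [hy' a, hy' a', Fin.sum_univ_three, Fin.sum_univ_three, hy0, hy1, hy2]
      exact trace_frame_mul_frame hij _ _ _ _ _ _
    have h2 : Matrix.trace ((M * y a * M') * (M * y a' * M')) = Matrix.trace (y a * y a') := by
      have : M * y a * M' * (M * y a' * M') = M * (y a * y a') * M' := by
        calc M * y a * M' * (M * y a' * M') = M * y a * (M' * M) * y a' * M' := by simp only [Matrix.mul_assoc]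
          _ = M * (y a * y a') * M' := by rw [hM'M, Matrix.mul_one]; simp only [Matrix.mul_assoc]
      rw [this, htrconj]
    have h3 : Matrix.trace (y a * y a') = -2 * (((if a = a' then (1 : ℝ) else 0 : ℝ)) : ℂ) := by
      rw [hyF a, hyF a', trace_frame_mul_frame hij]
      congr 2
      fin_cases a <;> fin_cases a' <;> simp
    have h4 : (((O a 0 * O a' 0 + O a 1 * O a' 1 + O a 2 * O a' 2 : ℝ)) : ℂ) = (((if a = a' then (1 : ℝ) else 0 : ℝ)) : ℂ) :=
      mul_left_cancel₀ (by norm_num : (-2 : ℂ) ≠ 0) (h1.symm.trans (h2.trans h3))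
    exact_mod_cast h4
  have hOO : O * Oᵀ = 1 := by
    ext a a'
    rw [Matrix.mul_apply, Matrix.one_apply, Fin.sum_univ_three]
    simp only [Matrix.transpose_apply]
    exact hrow a a'
  have hOtO : Oᵀ * O = 1 := mul_eq_one_comm.1 hOO
  -- the abstract trace invariance
  have key := Literature.LinearAlgebra.Matrix.sum_apply_apply_eq_of_transpose_mul_self_eq_one q y (fun a => M * y a * M') O hOtO hy'
  rw [Fin.sum_univ_three, Fin.sum_univ_three, hy0, hy1, hy2] at key
  exact key

end Literature.LinearAlgebra.Matrix.SU2Block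

end
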